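import Summits.AtomisticToContinuum.Crystallization.Theorems.ExcessDecayLiouvillePhononStabilityCertChargeD
import Summits.AtomisticToContinuum.Crystallization.Theorems.ExcessDecayLiouvillePhononStabilityCertChainAcc

/-!
# Near-certificate layer XII-e: the ACCUMULATED far charge over general step classes (lead c2, vertex scheme)

Support file for crux `PhononStability` (stmt-AtomisticToContinuum-9333), line `contragredient-window-collapse`.

The far chain charges of the range `(qn, qf]` along a chain assignment `ch` with steps in a fixed step list `sl`
(the classes of the difference star) are dominated by ONE pair form per step class: with the rational weights
`a_{c,s} = U_D(Q_c) · chainUp(ch c) · lloQ(Q_s)⁻¹` (layer XII-d),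
`chargeSum ≤ Σ_{s ∈ sl} pairEvalR s (T0_s + T1_s d̂ᵀ + d̂ T1_sᵀ + T2_s d̂ d̂ᵀ) w`
where `(T0, T1, T2)_s = Σ_{c, s ∈ ch c} a_{c,s} (ẑ⁰_c ẑ⁰_cᵀ, σ_c ẑ⁰_c, σ_c²)` is accumulated ONCE (cell independent,
natively; `chainAccD`) — the vertex scheme evaluates the 3 × 3 matrices at the shift coordinate `d̂` of each node.
Structure and proofs follow layer XII-c (`CertChainAcc`) with a general step list and weights.
-/

noncomputable section

open scoped BigOperators Classical InnerProductSpace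
open Filter Set Function
open Summit.AtomisticToContinuum.Crystallization.Theorems.PhononStabilityNegative
open Summit.AtomisticToContinuum.Crystallization.Theorems.PhononStabilityCWC.FarControlStub

namespace Summit.AtomisticToContinuum.Crystallization.Theorems.PhononStabilityCWC.Cert

local notation "E3" => EuclideanSpace ℝ (Fin 3)

/-! ## Accumulation with weights over a general step list -/

/-- the weight of (far class `c`, step `s`): `U_D(Q_c) · chainUp(ch c) · lloQ(Q_s)⁻¹` -/
def accW (D : ℕ) (ch : BondClass → List BondClass) (c s : BondClass) : ℚ :=
  uOfQD D (Qint c) * chainUp (ch c) * (lloQ (Qint s))⁻¹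

/-- add the contribution of far class `c` with weight `a` to an entry -/
def addW (a : ℚ) (c : BondClass) (e : AccE) : AccE :=
  let z := zhat0 c
  let s := sdiff c
  (flatMat fun i j => e.1 i j + a * (z i * z j), flatVec fun i => e.2.1 i + a * s * z i, e.2.2 + a * s ^ 2)

/-- bump the entry aligned with `s` in the step list -/
def bumpW (a : ℚ) (c s : BondClass) : List BondClass → List AccE → List AccE
  | [], _ => []
  | _ :: _, [] => []
  | n :: ns, e :: es => (if n = s then addW a c e else e) :: bumpW a c s ns es

/-- the zero table over a step list -/
def zeroTabW (sl : List BondClass) : List AccE := sl.map fun _ => ((fun _ _ => 0), (fun _ => 0), 0)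

/-- **the accumulated weighted chain table of the range `(qn, qf]`** (cell independent; computed once). -/
def chainAccD (D : ℕ) (ch : BondClass → List BondClass) (sl : List BondClass) (qn qf : ℤ) : List AccE :=
  (classRange qn qf).foldl (fun tab c => (ch c).foldl (fun tab s => bumpW (accW D ch c s) c s sl tab) tab) (zeroTabW sl)

/-- the contribution of one (class, weight): `a · P_s(ẑ_c(d) ẑ_c(d)ᵀ)`. [folklore] -/
theorem pairEvalR_accQ_addW {w : Label → E3} (hw : (support w).Finite) (a : ℚ) (c s : BondClass) (e : AccE)
    (d : Fin 3 → ℝ) :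
    pairEvalR s (accQ (addW a c e) d) w =
      pairEvalR s (accQ e d) w + (a : ℝ) * pairEvalR s (fun i j => zhat c d i * zhat c d j) w := by
  rw [← pairEvalR_smul, ← pairEvalR_add hw]
  congr 1
  funext i j
  simp only [accQ, addW, flatMat_eq, flatVec_eq, zhat]
  push_cast
  ring

/-- bumping at a class absent from the list does nothing. [folklore] -/
theorem bumpW_of_not_mem (a : ℚ) (c s : BondClass) :
    ∀ (ns : List BondClass) (tab : List AccE), s ∉ ns → tab.length = ns.length → bumpW a c s ns tab = tab := by
  intro ns
  induction ns with
  | nil => intro tab _ hlen; cases tab with | nil => rfl | cons _ _ => simp at hlen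
  | cons m ms ih =>
      intro tab hs hlen
      cases tab with
      | nil => rfl
      | cons f fs =>
          simp only [List.mem_cons, not_or] at hs
          simp only [List.length_cons, add_left_inj] at hlen
          simp only [bumpW, if_neg (Ne.symm hs.1), List.cons.injEq, true_and]
          exact ih fs hs.2 hlen

/-- `bumpW` preserves the length (of an aligned table). [folklore] -/
theorem length_bumpW (a : ℚ) (c s : BondClass) :
    ∀ (ns : List BondClass) (tab : List AccE), tab.length = ns.length → (bumpW a c s ns tab).length = ns.length := by
  intro ns
  induction ns with
  | nil => intro tab hlen; cases tab with | nil => rfl | cons _ _ => simp at hlen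
  | cons n ns ih =>
      intro tab hlen
      cases tab with
      | nil => simp at hlen
      | cons e es =>
          simp only [List.length_cons, add_left_inj] at hlen
          simp [bumpW, ih es hlen]

/-- bumping a table adds exactly the contribution at `s` (step list without duplicates). [folklore] -/
theorem accVal_bumpW {w : Label → E3} (hw : (support w).Finite) (d : Fin 3 → ℝ) (a : ℚ) (c s : BondClass) :
    ∀ (ns : List BondClass) (tab : List AccE), ns.Nodup → tab.length = ns.length → s ∈ ns →
      accVal d w ns (bumpW a c s ns tab) =
        accVal d w ns tab + (a : ℝ) * pairEvalR s (fun i j => zhat c d i * zhat c d j) w := by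
  intro ns
  induction ns with
  | nil => intro tab _ _ hs; simp at hs
  | cons n ns ih =>
      intro tab hnd hlen hs
      cases tab with
      | nil => simp at hlen
      | cons e es =>
          simp only [List.length_cons, add_left_inj] at hlen
          have hnd' : ns.Nodup := (List.nodup_cons.mp hnd).2
          have hn : n ∉ ns := (List.nodup_cons.mp hnd).1
          simp only [bumpW, accVal, List.zip_cons_cons, List.map_cons, List.sum_cons]
          by_cases hns : n = s
          · subst hns
            rw [if_pos rfl, pairEvalR_accQ_addW hw, bumpW_of_not_mem a c n ns es hn hlen]
            ring
          · rw [if_neg hns]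
            have hs' : s ∈ ns := by
              rcases List.mem_cons.mp hs with h | h
              · exact absurd h.symm hns
              · exact h
            have := ih es hnd' hlen hs'
            unfold accVal at this
            rw [this]
            ring

/-- folding the steps of one chain. [folklore] -/
theorem accVal_foldl_chainW {w : Label → E3} (hw : (support w).Finite) (d : Fin 3 → ℝ) {sl : List BondClass}
    (hsl : sl.Nodup) (a : BondClass → ℚ) (c : BondClass) :
    ∀ (chn : List BondClass) (tab : List AccE), tab.length = sl.length → (∀ s ∈ chn, s ∈ sl) →
      accVal d w sl (chn.foldl (fun tab s => bumpW (a s) c s sl tab) tab) =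
        accVal d w sl tab + (chn.map fun s => (a s : ℝ) * pairEvalR s (fun i j => zhat c d i * zhat c d j) w).sum ∧
      (chn.foldl (fun tab s => bumpW (a s) c s sl tab) tab).length = sl.length := by
  intro chn
  induction chn with
  | nil => intro tab hlen _; simp [hlen]
  | cons s rest ih =>
      intro tab hlen hmem
      rw [List.foldl_cons]
      have hs : s ∈ sl := hmem s (List.mem_cons_self ..)
      have hlen' : (bumpW (a s) c s sl tab).length = sl.length := length_bumpW (a s) c s sl tab hlen
      obtain ⟨h1, h2⟩ := ih (bumpW (a s) c s sl tab) hlen' (fun t ht => hmem t (List.mem_cons_of_mem _ ht))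
      refine ⟨?_, h2⟩
      rw [h1, accVal_bumpW hw d (a s) c s sl tab hsl hlen hs, List.map_cons, List.sum_cons]
      ring

/-- folding the far classes. [folklore] -/
theorem accVal_foldl_classesW {w : Label → E3} (hw : (support w).Finite) (d : Fin 3 → ℝ) {sl : List BondClass}
    (hsl : sl.Nodup) (D : ℕ) (ch : BondClass → List BondClass) :
    ∀ (cs : List BondClass) (tab : List AccE), tab.length = sl.length → (∀ c ∈ cs, ∀ s ∈ ch c, s ∈ sl) →
      accVal d w sl (cs.foldl (fun tab c => (ch c).foldl (fun tab s => bumpW (accW D ch c s) c s sl tab) tab) tab) =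
        accVal d w sl tab + (cs.map fun c => ((ch c).map fun s =>
          (accW D ch c s : ℝ) * pairEvalR s (fun i j => zhat c d i * zhat c d j) w).sum).sum ∧
      (cs.foldl (fun tab c => (ch c).foldl (fun tab s => bumpW (accW D ch c s) c s sl tab) tab) tab).length = sl.length := by
  intro cs
  induction cs with
  | nil => intro tab hlen _; simp [hlen]
  | cons c rest ih =>
      intro tab hlen hmem
      rw [List.foldl_cons]
      obtain ⟨h1, h2⟩ := accVal_foldl_chainW hw d hsl (fun s => accW D ch c s) c (ch c) tab hlen
        (hmem c (List.mem_cons_self ..))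
      obtain ⟨h3, h4⟩ := ih _ h2 (fun c' hc' => hmem c' (List.mem_cons_of_mem _ hc'))
      refine ⟨?_, h4⟩
      rw [h3, h1, List.map_cons, List.sum_cons]
      ring

/-- the zero table evaluates to zero. [folklore] -/
theorem accVal_zeroTabW (d : Fin 3 → ℝ) (w : Label → E3) (sl : List BondClass) : accVal d w sl (zeroTabW sl) = 0 := by
  unfold accVal zeroTabW
  have h0 : ∀ p ∈ sl.zip (sl.map fun _ => (((fun _ _ => 0), (fun _ => 0), 0) : AccE)),
      pairEvalR p.1 (accQ p.2 d) w = 0 := by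
    intro p hp
    have hp2 : p.2 = ((fun _ _ => 0), (fun _ => 0), 0) := by
      have := List.of_mem_zip hp
      obtain ⟨-, h⟩ := this
      rw [List.mem_map] at h
      obtain ⟨_, _, h⟩ := h
      exact h.symm
    have hq : accQ p.2 d = fun i j => (0 : ℝ) * (0 : ℝ) := by
      funext i j; simp [accQ, hp2]
    rw [hq, pairEvalR_smul, zero_mul]
  rw [List.map_congr_left h0]
  simp

/-- **the accumulated table evaluates to the weighted chain sums.** [folklore] -/
theorem accVal_chainAccD {w : Label → E3} (hw : (support w).Finite) (d : Fin 3 → ℝ) {sl : List BondClass}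
    (hsl : sl.Nodup) (D : ℕ) (ch : BondClass → List BondClass) (qn qf : ℤ)
    (hsteps : ∀ c ∈ classRange qn qf, ∀ s ∈ ch c, s ∈ sl) :
    accVal d w sl (chainAccD D ch sl qn qf) = ((classRange qn qf).map fun c => ((ch c).map fun s =>
      (accW D ch c s : ℝ) * pairEvalR s (fun i j => zhat c d i * zhat c d j) w).sum).sum := by
  unfold chainAccD
  obtain ⟨h1, -⟩ := accVal_foldl_classesW hw d hsl D ch (classRange qn qf) (zeroTabW sl) (by simp [zeroTabW]) hsteps
  rw [h1, accVal_zeroTabW, zero_add]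

/-! ## Domination of `chargeSum` -/

/-- the steps check: every chain step of the range lies in the step list and has `Q ≥ 36` -/
def stepsOK (ch : BondClass → List BondClass) (sl : List BondClass) (qn qf : ℤ) : Bool :=
  (classRange qn qf).all fun c => (ch c).all fun s => decide (s ∈ sl) && decide (36 ≤ Qint s)

/-- **THE ACCUMULATED TABLE DOMINATES THE CHAIN CHARGES** of the range (for `qn ≥ 144`, on the window). -/
theorem chargeSum_le_accVal {D : ℕ} (hD : 0 < D) {Rn Rf : ℝ} {bn bf : ℕ} {qn qf : ℤ} (hbn : ⌈2 * Rn⌉₊ + 1 = bn)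
    (hqn : ((qn : ℤ) : ℝ) = 36 * Rn ^ 2) (hbf : ⌈2 * Rf⌉₊ + 1 = bf) (hqf : ((qf : ℤ) : ℝ) = 36 * Rf ^ 2)
    (hRn : 2 ≤ Rn) (hRf : 0 ≤ Rf) (ch : BondClass → List BondClass) {sl : List BondClass} (hsl : sl.Nodup)
    (hok : stepsOK ch sl qn qf = true) {A : E3 →L[ℝ] E3} {δ : E3} (hW : CellWindow A) (hδ : ShiftWindow A δ)
    {w : Label → E3} (hw : (support w).Finite) :
    chargeSum Rn Rf ch A δ w ≤ accVal (contraOf δ) w sl (chainAccD D ch sl qn qf) := by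
  have hRn0 : 0 ≤ Rn := by linarith
  unfold stepsOK at hok
  rw [List.all_eq_true] at hok
  have hsteps : ∀ c ∈ classRange qn qf, ∀ s ∈ ch c, s ∈ sl ∧ 36 ≤ Qint s := by
    intro c hc s hs
    have h1 := hok c hc
    rw [List.all_eq_true] at h1
    have h2 := h1 s hs
    simp only [Bool.and_eq_true, decide_eq_true_eq] at h2
    exact h2
  rw [accVal_chainAccD hw (contraOf δ) hsl D ch qn qf (fun c hc s hs => (hsteps c hc s hs).1)]
  unfold chargeSum
  rw [sum_farClasses_eq hbn hqn hbf hqf hRn0 hRf]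
  refine List.sum_le_sum fun c hc => ?_
  have hQ : 144 ≤ Qint c := by
    obtain ⟨h1, -⟩ := qint_of_mem_classRange hc
    have : (144 : ℝ) ≤ (qn : ℝ) := by rw [hqn]; nlinarith
    have h144 : (144 : ℤ) ≤ qn := by exact_mod_cast this
    omega
  have hstep := charge_step_bound hD hW hδ hQ (fun s hs => (hsteps c hc s hs).2) w
  refine hstep.trans (le_of_eq ?_)
  unfold chainDirQ
  rw [← List.sum_map_mul_left]
  congr 1
  refine List.map_congr_left fun s _ => ?_
  rw [dirForm_eq_pairEvalR_zhat]
  unfold accW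
  push_cast
  ring

/-- Anchor of this support file (registered stub of the line skeleton, lead c2): the zero table over no steps. -/
theorem stub_certChargeAccD : chainAccD 1 (fun _ => []) [] 0 0 = [] := by
  rfl

end Summit.AtomisticToContinuum.Crystallization.Theorems.PhononStabilityCWC.Cert

end
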